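import Mathlib
import HarnessLib
import Summits.AtomisticToContinuum.Statement
import Literature.MathematicalPhysics.KineticTheory.BackwardCluster
import Summits.AtomisticToContinuum.HydrodynamicLimit.Theses.RelayRaceLocality
import Summits.AtomisticToContinuum.HydrodynamicLimit.Theorems.RelayRaceLocalityGibbsLightConeSimpleChainBridge

/-!
# Strategist sketch: typed split of the crux `RelayRaceLocality.GibbsLightCone`
(stmt-AtomisticToContinuum-12501) into its two sector tails over simple collision chains,
glued by the LANDED theorem
`LogWindowTaggedTail.gibbsLightCone_of_hotPathLengthTail_of_linkCountTail`.
The two `def`s below are the child statements VERBATIM (the hypotheses of that theorem).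
-/

namespace Summit.AtomisticToContinuum.HydrodynamicLimit.Theses.RelayRaceLocality

/-- Child 1 (hot sector): HOT PATH-LENGTH TAIL over simple chains. -/
def HotPathLengthTail : Prop :=
  open Literature.MathematicalPhysics.KineticTheory Literature.Analysis.FluidPDE MeasureTheory Filter in ∀ a θ : ℝ, 0 < a → 0 < θ → ∃ σ₀ : ℝ, 0 < σ₀ ∧ ∃ A lam c C : ℝ, 0 ≤ A ∧ 0 < c ∧ ∀ K : ℝ, 0 < K → ∀ σ : ℝ, 0 < σ → σ < σ₀ → ∀ Φ : (N : ℕ) → HardSphereFlow (Torus.geometry (Fin 3)) (hsDiameter σ N) (N + 1), ∀ᶠ N in atTop, ∀ p : Fin (N + 1), ∀ M : ℝ, 1 ≤ M → M ≤ K * Real.log ((N : ℝ) + 2) → localGibbsLaw σ (fun _ => a) (fun _ => 0) (fun _ => θ) N (Φ N) {z | ∃ (k : ℕ) (q : Fin (k + 1) → Fin (N + 1)) (T : Fin (k + 2) → ℝ), q (Fin.last k) = p ∧ Function.Injective q ∧ Monotone T ∧ StrictMono (fun m : Fin k => T (Fin.castSucc (Fin.succ m))) ∧ T 0 = 0 ∧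 T (Fin.last (k + 1)) = M * (((N + 1 : ℕ) : ℝ) ^ (-(1 / 3 : ℝ)) / σ ^ 2 / Real.sqrt θ) ∧ (∀ m : Fin k, s(q (Fin.castSucc m), q (Fin.succ m)) ∈ contactPairSet (Torus.geometry (Fin 3)) (hsDiameter σ N) ((Φ N).flow (T (Fin.castSucc (Fin.succ m))) z)) ∧ lam * M * (((N + 1 : ℕ) : ℝ) ^ (-(1 / 3 : ℝ)) / σ ^ 2) < ∑ m : Fin (k + 1), ∫ u in T (Fin.castSucc m)..T (Fin.succ m), (if A * Real.sqrt θ < ‖(((Φ N).flow u z) (q m)).2‖ then ‖(((Φ N).flow u z) (q m)).2‖ else 0)} ≤ ENNReal.ofReal (C * Real.exp (-c * M))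

/-- Child 2 (link sector): LINK-COUNT TAIL over simple chains. -/
def LinkCountTail : Prop :=
  open Literature.MathematicalPhysics.KineticTheory Literature.Analysis.FluidPDE MeasureTheory Filter in ∀ a θ : ℝ, 0 < a → 0 < θ → ∃ σ₀ : ℝ, 0 < σ₀ ∧ ∃ lam c C : ℝ, 0 < c ∧ ∀ K : ℝ, 0 < K → ∀ σ : ℝ, 0 < σ → σ < σ₀ → ∀ Φ : (N : ℕ) → HardSphereFlow (Torus.geometry (Fin 3)) (hsDiameter σ N) (N + 1), ∀ᶠ N in atTop, ∀ p : Fin (N + 1), ∀ M : ℝ, 1 ≤ M → M ≤ K * Real.log ((N : ℝ) + 2) → localGibbsLaw σ (fun _ => a) (fun _ => 0) (fun _ => θ) N (Φ N) {z | ∃ (k : ℕ) (q : Fin (k + 1) → Fin (N + 1)) (T : Fin (k + 2) → ℝ), q (Fin.last k) = p ∧ Function.Injective q ∧ Monotone T ∧ StrictMono (fun m : Fin k => T (Fin.castSucc (Fin.succ m))) ∧ T 0 = 0 ∧ T (Fin.last (k + 1)) = M * (((N + 1 : ℕ) : ℝ) ^ (-(1 / 3 : ℝ)) / σ ^ 2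 / Real.sqrt θ) ∧ (∀ m : Fin k, s(q (Fin.castSucc m), q (Fin.succ m)) ∈ contactPairSet (Torus.geometry (Fin 3)) (hsDiameter σ N) ((Φ N).flow (T (Fin.castSucc (Fin.succ m))) z)) ∧ lam * M * (((N + 1 : ℕ) : ℝ) ^ (-(1 / 3 : ℝ)) / σ ^ 2) < k * hsDiameter σ N} ≤ ENNReal.ofReal (C * Real.exp (-c * M))

/-- The glue, by the landed bridge (no new mathematics). -/
theorem GibbsLightCone_of_subs : HotPathLengthTail → LinkCountTail → GibbsLightCone :=
  Summit.AtomisticToContinuum.HydrodynamicLimit.Theorems.LogWindowTaggedTail.gibbsLightCone_of_hotPathLengthTail_of_linkCountTail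

end Summit.AtomisticToContinuum.HydrodynamicLimit.Theses.RelayRaceLocality
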